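import Literature.NumberTheory.LFunctions.MollifierSelbergCoordinates
import Literature.NumberTheory.LFunctions.KMVAmplifiedDiagonalForms
import Literature.NumberTheory.Multiplicative.DivisorHeckeRelation
import Literature.Barriers.RiemannHypothesis.MollifierLimitationsPropBDiag
import HarnessLib

/-!
# The KMV second-moment kernel in Selberg coordinates: the bridge identity (Claim 1)

Topic `Literature/NumberTheory/LFunctions` (namespace `Literature.NumberTheory.LFunctions.KMV2000`,
sub-namespace `SelbergCoord`). PROVED, elementary; no named facts.

`MollifierSelbergCoordinates` proves Soundararajan's completion-of-squares bound for the form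
`F_{M,L}(A) = Σ φ(n)(L + κ(n))A_n² − 2Σ_{n|m} φ(n)Λ(m/n)A_nA_m` (`SelbergCoord.scForm`) TAKEN AS THE
OBJECT, and `KMVAmplifiedDiagonalForms` types the diagonal second-moment kernel of
[KowalskiMichelVanderKam2000] (21)–(23), `K(a,b) = (ab)⁻¹ Σ_{c∣(a,b)} c·τ(ab/c²)·(L + log c − ½log(ab))`
(`KMV2000.kmvKernel`). This file proves the exact identity linking them (the cell's «Claim 1»,
`B-fam/num-2/fame09/FAME09-MODEL-THEOREM.md` §2; checked symbolically there, refereed in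
`B-fam/REF.md` Block 7): with the **Selberg coordinates** `A_n(x) := Σ_{n∣m≤M} τ(m/n)·x_m/m`,

  `Σ_{a,b≤M} x_a x_b K(a,b) = F_{M,L}(A(x))`   and   `Σ_{a≤M} x_a/a = Σ_{n≤M} μ(n)A_n(x)`,

so that `SelbergCoord.mobForm_sq_mul_le_scForm` becomes, literally, the bound
`(Σ x_a/a)²·m_* ≤ Σ x_a x_b K(a,b)` for every real coefficient vector `x` — the MODEL-level hard
half of famE-09 (`KMV2000.LinearMollifierOptimality`) for the kernel both numerics lineages computed.

## Proof (arithmetic-function identities, all elementary)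
* (N1) Hecke relation for `τ`: `τ(u)τ(v) = Σ_{c∣(u,v)} τ((u/c)(v/c))`
  (`Multiplicative.card_divisors_mul_card_divisors_eq_sum`);
* (N2) `c = Σ_{n∣c} φ(n)` (`Nat.sum_totient`);
* (N3) `c·log c = Σ_{n∣c} h(n)` with `h = φ·log + φ⋆Λ` (`PropB.sum_divisors_hAF`) and the prime-power
  evaluation `(φ⋆Λ)(n) = φ(n)κ(n)` (`sum_divisors_vonMangoldt_mul_totient`, proved here);
* (N4) `Σ_{d∣u} Λ(d)τ(u/d) = Σ_{e∣u} log e = ½τ(u) log u`.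
Per pair `(a,b)`: `ab·K(a,b) = Σ_{n∣(a,b)} [φ(n)(L+κ(n))τ(a/n)τ(b/n) − φ(n)τ(b/n)Θ(a/n) − φ(n)τ(a/n)Θ(b/n)]`
with `Θ(u) = Σ_{d∣u}Λ(d)τ(u/d)` (`kerNum_eq`); summing against `x_ax_b/(ab)` and exchanging the
order of summation gives the two sides of `scForm`.

## References
* [KowalskiMichelVanderKam2000] (10) p. 7, (21)–(23) pp. 12–13 — the kernel.
* [Radziwill2012] §7 — the Selberg-coordinates form (ζ case; the tree's `PropB` files).
-/

noncomputable section

open Finset ArithmeticFunction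
open scoped ArithmeticFunction.zeta ArithmeticFunction.Moebius

namespace Literature.NumberTheory.LFunctions.KMV2000.SelbergCoord

open Literature.Barriers.RiemannHypothesis.PropB (hAF sum_divisors_hAF sum_divisors_gcd_eq_sum_Icc_ite)
open Literature.NumberTheory.Multiplicative (cast_card_divisors_mul_card_divisors)

/-! ### (N3′) The prime-power evaluation `(Λ ⋆ φ)(n) = φ(n)·κ(n)` -/

/-- `Σ_{d ∣ n} Λ(d)·φ(n/d) = φ(n)·κ(n)` with `κ(n) = Σ_{p∣n} log p/(p−1)`: at a prime power
`Σ_{1≤i≤k} log p·φ(p^{k−i}) = p^{k−1} log p = φ(p^k)·log p/(p−1)`, and both sides are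
«additive-times-φ» over coprime factors. [cite: Radziwill2012, §7 proof of Lemma 12 (the evaluation of `φ ⋆ Λ`) — derivation] -/
theorem sum_divisors_vonMangoldt_mul_totient (n : ℕ) :
    ∑ d ∈ n.divisors, Λ d * (Nat.totient (n / d) : ℝ) = (Nat.totient n : ℝ) * kappa n := by
  induction n using Nat.recOnPrimeCoprime with
  | zero => simp
  | prime_pow p k hp =>
    rcases Nat.eq_zero_or_pos k with rfl | hk
    · simp [kappa]
    · rw [Nat.sum_divisors_prime_pow hp]
      have hp1 : (1 : ℝ) < p := by exact_mod_cast hp.one_lt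
      have hp0 : (p : ℝ) - 1 ≠ 0 := by linarith
      -- the terms: i = 0 vanishes, i ≥ 1 gives log p · φ(p^(k-i))
      have hterm : ∀ i ∈ range (k + 1), Λ (p ^ i) * (Nat.totient (p ^ k / p ^ i) : ℝ)
          = if i = 0 then 0 else Real.log p * (Nat.totient (p ^ (k - i)) : ℝ) := by
        intro i hi
        have hik : i ≤ k := Nat.lt_succ_iff.mp (mem_range.mp hi)
        split_ifs with h0
        · subst h0; simp
        · rw [vonMangoldt_apply_pow h0, vonMangoldt_apply_prime hp, Nat.pow_div hik hp.pos]
      rw [sum_congr rfl hterm]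
      -- Σ_{i=1}^{k} φ(p^(k-i)) = Σ_{j=0}^{k-1} φ(p^j) = Σ_{d | p^(k-1)} φ(d) = p^(k-1)
      have hsum : ∑ i ∈ range (k + 1), (if i = 0 then (0 : ℝ) else Real.log p * (Nat.totient (p ^ (k - i)) : ℝ))
          = Real.log p * ((p : ℝ) ^ (k - 1)) := by
        rw [Finset.sum_range_succ', if_pos rfl, add_zero]
        simp only [Nat.succ_ne_zero, if_false]
        rw [← mul_sum]
        congr 1
        have h1 : ∑ j ∈ range k, (Nat.totient (p ^ (k - (j + 1))) : ℝ)
            = ∑ j ∈ range k, (Nat.totient (p ^ j) : ℝ) := by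
          have := Finset.sum_range_reflect (fun j => (Nat.totient (p ^ j) : ℝ)) k
          rw [← this]
          refine sum_congr rfl fun j hj => ?_
          have hjk : j < k := mem_range.mp hj
          rw [show k - (j + 1) = k - 1 - j from by omega]
        rw [h1]
        have h2 : ∑ j ∈ range k, (Nat.totient (p ^ j) : ℝ) = ∑ d ∈ (p ^ (k - 1)).divisors, (Nat.totient d : ℝ) := by
          rw [Nat.sum_divisors_prime_pow hp, Nat.sub_add_cancel (Nat.one_le_iff_ne_zero.mpr hk.ne')]
        rw [h2, ← Nat.cast_sum, Nat.sum_totient]; push_cast; ring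
      rw [hsum, Nat.totient_prime_pow hp hk, kappa, Nat.primeFactors_prime_pow hk.ne' hp, sum_singleton]
      push_cast [Nat.one_le_iff_ne_zero.mpr hp.ne_zero]
      field_simp
  | coprime a b ha hb hab iha ihb =>
    have ha0 : a ≠ 0 := by omega
    have hb0 : b ≠ 0 := by omega
    -- restrict to prime-power divisors (Λ vanishes elsewhere)
    have key : ∀ m : ℕ, ∑ d ∈ m.divisors, Λ d * (Nat.totient (m / d) : ℝ)
        = ∑ d ∈ m.divisors.filter IsPrimePow, Real.log (Nat.minFac d) * (Nat.totient (m / d) : ℝ) := by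
      intro m
      rw [sum_filter]
      refine sum_congr rfl fun d _ => ?_
      rw [vonMangoldt_apply]
      split_ifs <;> simp
    rw [key] at iha ihb ⊢
    rw [Nat.mul_divisors_filter_prime_pow hab, filter_union,
      sum_union (Nat.disjoint_divisors_filter_isPrimePow hab)]
    -- on divisors of `a`: φ(ab/d) = φ(a/d)·φ(b)
    have hA : ∑ d ∈ a.divisors.filter IsPrimePow, Real.log (Nat.minFac d) * (Nat.totient (a * b / d) : ℝ)
        = (Nat.totient b : ℝ) * ∑ d ∈ a.divisors.filter IsPrimePow, Real.log (Nat.minFac d) * (Nat.totient (a / d) : ℝ) := by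
      rw [mul_sum]
      refine sum_congr rfl fun d hd => ?_
      have hda : d ∣ a := Nat.dvd_of_mem_divisors (mem_filter.mp hd).1
      have hcop : Nat.Coprime (a / d) b := Nat.Coprime.coprime_dvd_left (Nat.div_dvd_of_dvd hda) hab
      rw [Nat.mul_comm a b, Nat.mul_div_assoc b hda, Nat.mul_comm b, Nat.totient_mul hcop]
      push_cast; ring
    have hB : ∑ d ∈ b.divisors.filter IsPrimePow, Real.log (Nat.minFac d) * (Nat.totient (a * b / d) : ℝ)
        = (Nat.totient a : ℝ) * ∑ d ∈ b.divisors.filter IsPrimePow, Real.log (Nat.minFac d) * (Nat.totient (b / d) : ℝ) := by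
      rw [mul_sum]
      refine sum_congr rfl fun d hd => ?_
      have hdb : d ∣ b := Nat.dvd_of_mem_divisors (mem_filter.mp hd).1
      have hcop : Nat.Coprime a (b / d) := Nat.Coprime.coprime_dvd_right (Nat.div_dvd_of_dvd hdb) hab
      rw [Nat.mul_div_assoc a hdb, Nat.totient_mul hcop]
      push_cast; ring
    rw [hA, hB, iha, ihb, Nat.totient_mul hab, kappa, kappa, kappa, Nat.Coprime.primeFactors_mul hab,
      sum_union (Nat.Coprime.disjoint_primeFactors hab)]
    push_cast; ring

/-- `h(n) = φ(n)·(log n + κ(n))`, where `h = φ·log + φ⋆Λ` is the arithmetic function of the tree's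
`PropB` file with `Σ_{ℓ∣n} h(ℓ) = n log n`. [cite: Radziwill2012, §7 proof of Lemma 12 — derivation] -/
theorem hAF_eq (n : ℕ) : hAF n = (Nat.totient n : ℝ) * (Real.log n + kappa n) := by
  rw [hAF, ArithmeticFunction.add_apply, Literature.Barriers.RiemannHypothesis.PropB.Dlog_apply,
    Literature.Barriers.RiemannHypothesis.PropB.phiR_apply, ArithmeticFunction.mul_apply]
  simp only [Literature.Barriers.RiemannHypothesis.PropB.phiR_apply]
  rw [Nat.sum_divisorsAntidiagonal' (fun i j => (Nat.totient i : ℝ) * Λ j)]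
  have : ∑ i ∈ n.divisors, (Nat.totient (n / i) : ℝ) * Λ i
      = ∑ d ∈ n.divisors, Λ d * (Nat.totient (n / d) : ℝ) :=
    sum_congr rfl fun d _ => mul_comm _ _
  rw [this, sum_divisors_vonMangoldt_mul_totient]
  ring

/-! ### (N4) `Σ_{d∣u} Λ(d)τ(u/d) = ½ τ(u) log u` -/

/-- `Θ(u) = Σ_{d ∣ u} Λ(d)·τ(u/d)`. [cite: KowalskiMichelVanderKam2000, (23) p. 13 — derivation (bookkeeping function)] -/
def theta (u : ℕ) : ℝ := ∑ d ∈ u.divisors, Λ d * ((u / d).divisors.card : ℝ)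

/-- `2·Θ(u) = τ(u)·log u`: `Σ_{d∣u}Λ(d)τ(u/d) = Σ_{e∣u} log e` (as `Λ⋆τ = Λ⋆ζ⋆ζ = log⋆ζ`) and
`Σ_{e∣u} log e = Σ_{e∣u} log(u/e)`. [cite: KowalskiMichelVanderKam2000, (23) p. 13 — derivation] -/
theorem two_mul_theta (u : ℕ) : 2 * theta u = (u.divisors.card : ℝ) * Real.log u := by
  rcases eq_or_ne u 0 with rfl | hu
  · simp [theta]
  -- (ζ ⋆ ζ)(e) = τ(e)
  have hzz : ∀ e : ℕ, e ≠ 0 → ((ζ : ArithmeticFunction ℝ) * ζ) e = (e.divisors.card : ℝ) := by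
    intro e he
    rw [coe_mul_zeta_apply]
    have : ∀ i ∈ e.divisors, ((ζ : ArithmeticFunction ℝ)) i = 1 := by
      intro i hi
      have hi0 : i ≠ 0 := Nat.pos_iff_ne_zero.mp (Nat.pos_of_mem_divisors hi)
      rw [natCoe_apply, zeta_apply, if_neg hi0, Nat.cast_one]
    rw [sum_congr rfl this, sum_const, nsmul_eq_mul, mul_one]
  -- Σ_d Λ(d) τ(u/d) = (Λ ⋆ ζ ⋆ ζ)(u) = Σ_{e | u} log e
  have h1 : theta u = ∑ e ∈ u.divisors, Real.log e := by
    have hA : theta u = (Λ * ((ζ : ArithmeticFunction ℝ) * ζ)) u := by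
      rw [ArithmeticFunction.mul_apply, Nat.sum_divisorsAntidiagonal (fun i j => Λ i * ((ζ : ArithmeticFunction ℝ) * ζ) j)]
      unfold theta
      refine sum_congr rfl fun d hd => ?_
      have hd0 : u / d ≠ 0 := by
        obtain ⟨hdu, hu0⟩ := Nat.mem_divisors.mp hd
        exact (Nat.div_ne_zero_iff_of_dvd hdu).mpr ⟨hu0, Nat.pos_iff_ne_zero.mp (Nat.pos_of_mem_divisors hd)⟩
      rw [hzz _ hd0]
    have hB : (Λ * ((ζ : ArithmeticFunction ℝ) * ζ)) u = ∑ e ∈ u.divisors, Real.log e := by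
      rw [← mul_assoc, vonMangoldt_mul_zeta, coe_mul_zeta_apply]
      exact sum_congr rfl fun e _ => log_apply
    rw [hA, hB]
  -- 2 Σ_{e|u} log e = Σ_{e|u} (log e + log (u/e)) = τ(u) log u
  have h2 : ∑ e ∈ u.divisors, Real.log e = ∑ e ∈ u.divisors, Real.log ((u / e : ℕ) : ℝ) :=
    (Nat.sum_div_divisors u (fun e => Real.log e)).symm
  have h3 : ∀ e ∈ u.divisors, Real.log e + Real.log ((u / e : ℕ) : ℝ) = Real.log u := by
    intro e he
    obtain ⟨heu, -⟩ := Nat.mem_divisors.mp he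
    have he0 : (e : ℝ) ≠ 0 := by exact_mod_cast Nat.pos_iff_ne_zero.mp (Nat.pos_of_mem_divisors he)
    have hu0 : (u : ℝ) ≠ 0 := by exact_mod_cast hu
    rw [Nat.cast_div heu he0, Real.log_div hu0 he0]
    ring
  calc 2 * theta u = ∑ e ∈ u.divisors, Real.log e + ∑ e ∈ u.divisors, Real.log ((u / e : ℕ) : ℝ) := by
        rw [h1, ← h2]; ring
    _ = ∑ e ∈ u.divisors, Real.log (u : ℝ) := by
        rw [← sum_add_distrib]; exact sum_congr rfl h3
    _ = (u.divisors.card : ℝ) * Real.log u := by rw [sum_const, nsmul_eq_mul]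


/-! ### Reindexing lemmas -/

/-- `Σ_{c∣g} Σ_{n∣c} F(n,c) = Σ_{n∣g} Σ_{e∣g/n} F(n, ne)` (`g ≠ 0`). [folklore] -/
private theorem sum_div_sum_div_comm {β : Type*} [AddCommMonoid β] {g : ℕ} (hg : g ≠ 0)
    (F : ℕ → ℕ → β) :
    ∑ c ∈ g.divisors, ∑ n ∈ c.divisors, F n c =
      ∑ n ∈ g.divisors, ∑ e ∈ (g / n).divisors, F n (n * e) := by
  -- step 1: exchange to `Σ_{n ∣ g} Σ_{c ∣ g, n ∣ c}`
  have h1 : ∑ c ∈ g.divisors, ∑ n ∈ c.divisors, F n c =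
      ∑ n ∈ g.divisors, ∑ c ∈ g.divisors.filter (fun c => n ∣ c), F n c := by
    refine Finset.sum_comm' ?_
    intro c n
    simp only [Nat.mem_divisors, mem_filter]
    constructor
    · rintro ⟨⟨hcg, hg0⟩, hnc, hc0⟩
      exact ⟨⟨⟨hcg, hg0⟩, hnc⟩, hnc.trans hcg, hg0⟩
    · rintro ⟨⟨⟨hcg, hg0⟩, hnc⟩, hng, -⟩
      refine ⟨⟨hcg, hg0⟩, hnc, ?_⟩
      rintro rfl; exact hg0 (zero_dvd_iff.mp hcg)
  rw [h1]
  refine sum_congr rfl fun n hn => ?_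
  obtain ⟨hng, -⟩ := Nat.mem_divisors.mp hn
  have hn0 : n ≠ 0 := by rintro rfl; exact hg (zero_dvd_iff.mp hng)
  -- step 2: `c = n e`, `e ∣ g/n`
  symm
  refine Finset.sum_nbij' (fun e => n * e) (fun c => c / n) ?_ ?_ ?_ ?_ ?_
  · intro e he
    obtain ⟨heg, hgn⟩ := Nat.mem_divisors.mp he
    simp only [mem_filter, Nat.mem_divisors]
    refine ⟨⟨?_, hg⟩, dvd_mul_right n e⟩
    have := mul_dvd_mul_left n heg
    rwa [Nat.mul_div_cancel' hng] at this
  · intro c hc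
    simp only [mem_filter, Nat.mem_divisors] at hc
    obtain ⟨⟨hcg, -⟩, hnc⟩ := hc
    refine Nat.mem_divisors.mpr ⟨?_, (Nat.div_ne_zero_iff_of_dvd hng).mpr ⟨hg, hn0⟩⟩
    obtain ⟨k, rfl⟩ := hnc
    obtain ⟨m, hm⟩ := hng
    rw [hm, Nat.mul_div_cancel_left k (Nat.pos_of_ne_zero hn0),
      Nat.mul_div_cancel_left m (Nat.pos_of_ne_zero hn0)]
    exact Nat.dvd_of_mul_dvd_mul_left (Nat.pos_of_ne_zero hn0) (hm ▸ hcg)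
  · intro e he
    show n * e / n = e
    exact Nat.mul_div_cancel_left e (Nat.pos_of_ne_zero hn0)
  · intro c hc
    simp only [mem_filter, Nat.mem_divisors] at hc
    show n * (c / n) = c
    exact Nat.mul_div_cancel' hc.2
  · intro e he; rfl

/-- `Σ_{m≤M, n∣m, m∣a} F(m) = Σ_{d∣a/n} F(nd)` for `n ∣ a`, `1 ≤ a ≤ M`. [folklore] -/
private theorem sum_Icc_ite_dvd_dvd {β : Type*} [AddCommMonoid β] {M n a : ℕ} (ha : a ∈ Icc 1 M)
    (hn : n ≠ 0) (hna : n ∣ a) (F : ℕ → β) :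
    ∑ m ∈ Icc 1 M, (if n ∣ m ∧ m ∣ a then F m else 0) = ∑ d ∈ (a / n).divisors, F (n * d) := by
  obtain ⟨ha1, haM⟩ := mem_Icc.mp ha
  have ha0 : a ≠ 0 := by omega
  rw [← sum_filter]
  symm
  refine Finset.sum_nbij' (fun d => n * d) (fun m => m / n) ?_ ?_ ?_ ?_ ?_
  · intro d hd
    obtain ⟨hda, han⟩ := Nat.mem_divisors.mp hd
    have hnd : n * d ∣ a := by
      have := mul_dvd_mul_left n hda; rwa [Nat.mul_div_cancel' hna] at this
    simp only [mem_filter, mem_Icc]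
    refine ⟨⟨?_, (Nat.le_of_dvd (by omega) hnd).trans haM⟩, dvd_mul_right n d, hnd⟩
    have hd0 : d ≠ 0 := by rintro rfl; simp at hnd; omega
    exact Nat.one_le_iff_ne_zero.mpr (mul_ne_zero hn hd0)
  · intro m hm
    simp only [mem_filter, mem_Icc] at hm
    obtain ⟨-, hnm, hma⟩ := hm
    refine Nat.mem_divisors.mpr ⟨?_, (Nat.div_ne_zero_iff_of_dvd hna).mpr ⟨ha0, hn⟩⟩
    obtain ⟨k, rfl⟩ := hnm
    obtain ⟨c, hc⟩ := hna
    rw [hc, Nat.mul_div_cancel_left k (Nat.pos_of_ne_zero hn),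
      Nat.mul_div_cancel_left c (Nat.pos_of_ne_zero hn)]
    exact Nat.dvd_of_mul_dvd_mul_left (Nat.pos_of_ne_zero hn) (hc ▸ hma)
  · intro d hd
    show n * d / n = d
    exact Nat.mul_div_cancel_left d (Nat.pos_of_ne_zero hn)
  · intro m hm
    simp only [mem_filter, mem_Icc] at hm
    show n * (m / n) = m
    exact Nat.mul_div_cancel' hm.2.1
  · intro d hd; rfl

/-! ### The kernel numerator and the per-pair identity -/

/-- `τ(m)` as a real number. [cite: KowalskiMichelVanderKam2000, (23) p. 13 — derivation (notation)] -/
def tauR (m : ℕ) : ℝ := (m.divisors.card : ℝ)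

/-- The numerator of the KMV kernel: `N(a,b) = Σ_{c∣(a,b)} c·τ((a/c)(b/c))·(L + log c − ½(log a + log b))`,
so that `kmvKernel L a b = N(a,b)/(ab)`. [cite: KowalskiMichelVanderKam2000, (23) p. 13 — derivation] -/
def kerNum (L : ℝ) (a b : ℕ) : ℝ :=
  ∑ c ∈ (Nat.gcd a b).divisors,
    (c : ℝ) * ((a / c * (b / c)).divisors.card : ℝ) * (L + Real.log c - (Real.log a + Real.log b) / 2)

/-- `kmvKernel L a b = N(a,b)/(ab)` (unfolding). [cite: KowalskiMichelVanderKam2000, (23) p. 13 — derivation] -/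
theorem kmvKernel_eq_kerNum_div (L : ℝ) (a b : ℕ) :
    kmvKernel L a b = kerNum L a b / ((a : ℝ) * b) := rfl

/-- **The per-pair identity.** For `a, b ≥ 1`,
`N(a,b) = Σ_{n∣(a,b)} [φ(n)(L+κ(n))τ(a/n)τ(b/n) − φ(n)τ(b/n)Θ(a/n) − φ(n)τ(a/n)Θ(b/n)]`:
write `c(L − ½log ab) + c log c = Σ_{n∣c}[φ(n)(L − ½log ab) + h(n)]` ((N2), (N3)), exchange the
`c`- and `n`-sums, apply the Hecke relation (N1) to `(a/n, b/n)`, and use `h(n) = φ(n)(log n + κ(n))`,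
`log n − ½(log a + log b) = −½(log(a/n) + log(b/n))`, `τ(u) log u = 2Θ(u)` ((N4)).
[cite: KowalskiMichelVanderKam2000, (21)–(23) pp. 12–13 — derivation (Selberg coordinates, the cell's Claim 1)] -/
theorem kerNum_eq {a b : ℕ} (ha : a ≠ 0) (hb : b ≠ 0) (L : ℝ) :
    kerNum L a b = ∑ n ∈ (Nat.gcd a b).divisors,
      ((Nat.totient n : ℝ) * (L + kappa n) * tauR (a / n) * tauR (b / n)
        - (Nat.totient n : ℝ) * tauR (b / n) * theta (a / n)
        - (Nat.totient n : ℝ) * tauR (a / n) * theta (b / n)) := by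
  set g := Nat.gcd a b with hgdef
  have hg : g ≠ 0 := Nat.gcd_ne_zero_left ha
  set ℓ : ℝ := (Real.log a + Real.log b) / 2 with hℓ
  -- (N2)+(N3): c (L - ℓ) + c log c = Σ_{n | c} W n
  set W : ℕ → ℝ := fun n => (Nat.totient n : ℝ) * (L - ℓ) + hAF n with hW
  have hS1 : ∀ c ∈ g.divisors, (c : ℝ) * (L + Real.log c - ℓ) = ∑ n ∈ c.divisors, W n := by
    intro c hc
    simp only [hW, sum_add_distrib, ← sum_mul]
    rw [← Nat.cast_sum, Nat.sum_totient, sum_divisors_hAF]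
    ring
  -- rewrite the numerator as a double sum and exchange
  have hS2 : kerNum L a b = ∑ n ∈ g.divisors, W n * ∑ e ∈ (g / n).divisors, tauR (a / n / e * (b / n / e)) := by
    unfold kerNum
    rw [← hgdef]
    have : ∀ c ∈ g.divisors, (c : ℝ) * ((a / c * (b / c)).divisors.card : ℝ) * (L + Real.log c - ℓ)
        = ∑ n ∈ c.divisors, W n * tauR (a / c * (b / c)) := by
      intro c hc
      rw [mul_comm (c : ℝ), mul_assoc, hS1 c hc, mul_sum]
      exact sum_congr rfl fun n _ => by unfold tauR; ring
    rw [sum_congr rfl this, sum_div_sum_div_comm hg (fun n c => W n * tauR (a / c * (b / c)))]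
    refine sum_congr rfl fun n _ => ?_
    rw [mul_sum]
    refine sum_congr rfl fun e _ => ?_
    rw [Nat.div_div_eq_div_mul, Nat.div_div_eq_div_mul]
  -- (N1): the inner sum is τ(a/n) τ(b/n)
  have hS3 : ∀ n ∈ g.divisors, ∑ e ∈ (g / n).divisors, tauR (a / n / e * (b / n / e)) = tauR (a / n) * tauR (b / n) := by
    intro n hn
    obtain ⟨hng, -⟩ := Nat.mem_divisors.mp hn
    have hna : n ∣ a := hng.trans (Nat.gcd_dvd_left a b)
    have hnb : n ∣ b := hng.trans (Nat.gcd_dvd_right a b)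
    have hn0 : n ≠ 0 := by rintro rfl; exact hg (zero_dvd_iff.mp hng)
    have han : a / n ≠ 0 := (Nat.div_ne_zero_iff_of_dvd hna).mpr ⟨ha, hn0⟩
    have hbn : b / n ≠ 0 := (Nat.div_ne_zero_iff_of_dvd hnb).mpr ⟨hb, hn0⟩
    have hgcd : g / n = Nat.gcd (a / n) (b / n) := by rw [hgdef, Nat.gcd_div hna hnb]
    rw [hgcd]
    unfold tauR
    rw [cast_card_divisors_mul_card_divisors (R := ℝ) han hbn]
  -- assemble
  rw [hS2]
  refine sum_congr rfl fun n hn => ?_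
  obtain ⟨hng, -⟩ := Nat.mem_divisors.mp hn
  have hna : n ∣ a := hng.trans (Nat.gcd_dvd_left a b)
  have hnb : n ∣ b := hng.trans (Nat.gcd_dvd_right a b)
  have hn0 : n ≠ 0 := by rintro rfl; exact hg (zero_dvd_iff.mp hng)
  have hnR : (n : ℝ) ≠ 0 := by exact_mod_cast hn0
  have haR : (a : ℝ) ≠ 0 := by exact_mod_cast ha
  have hbR : (b : ℝ) ≠ 0 := by exact_mod_cast hb
  rw [hS3 n hn]
  -- log bookkeeping: log(a/n) = log a - log n etc., and τ(u) log u = 2 Θ(u)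
  have hla : Real.log ((a / n : ℕ) : ℝ) = Real.log a - Real.log n := by
    rw [Nat.cast_div hna hnR, Real.log_div haR hnR]
  have hlb : Real.log ((b / n : ℕ) : ℝ) = Real.log b - Real.log n := by
    rw [Nat.cast_div hnb hnR, Real.log_div hbR hnR]
  have hta : tauR (a / n) * Real.log ((a / n : ℕ) : ℝ) = 2 * theta (a / n) := by
    unfold tauR; rw [two_mul_theta]
  have htb : tauR (b / n) * Real.log ((b / n : ℕ) : ℝ) = 2 * theta (b / n) := by
    unfold tauR; rw [two_mul_theta]
  simp only [hW, hℓ, hAF_eq]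
  rw [hla] at hta
  rw [hlb] at htb
  -- now a polynomial identity in the atoms, using hta/htb to eliminate log a, log b
  have e1 : tauR (a / n) * Real.log a = 2 * theta (a / n) + tauR (a / n) * Real.log n := by linarith
  have e2 : tauR (b / n) * Real.log b = 2 * theta (b / n) + tauR (b / n) * Real.log n := by linarith
  have key : (Nat.totient n : ℝ) * (L - (Real.log a + Real.log b) / 2) + (Nat.totient n : ℝ) * (Real.log n + kappa n)
      = (Nat.totient n : ℝ) * (L + kappa n) - (Nat.totient n : ℝ) * ((Real.log a - Real.log n) + (Real.log b - Real.log n)) / 2 := by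
    ring
  rw [key]
  have : (Nat.totient n : ℝ) * ((Real.log a - Real.log n) + (Real.log b - Real.log n)) / 2 * (tauR (a / n) * tauR (b / n))
      = (Nat.totient n : ℝ) * tauR (b / n) * theta (a / n) + (Nat.totient n : ℝ) * tauR (a / n) * theta (b / n) := by
    have h3 : (Real.log a - Real.log n) * tauR (a / n) = 2 * theta (a / n) := by linarith
    have h4 : (Real.log b - Real.log n) * tauR (b / n) = 2 * theta (b / n) := by linarith
    calc (Nat.totient n : ℝ) * ((Real.log a - Real.log n) + (Real.log b - Real.log n)) / 2 * (tauR (a / n) * tauR (b / n))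
        = (Nat.totient n : ℝ) / 2 * (((Real.log a - Real.log n) * tauR (a / n)) * tauR (b / n)
            + ((Real.log b - Real.log n) * tauR (b / n)) * tauR (a / n)) := by ring
      _ = (Nat.totient n : ℝ) * tauR (b / n) * theta (a / n) + (Nat.totient n : ℝ) * tauR (a / n) * theta (b / n) := by
          rw [h3, h4]; ring
  rw [sub_mul, this]
  ring

/-! ### Selberg coordinates and the global identity -/

/-- **Selberg coordinates** of a coefficient vector `x` (length `M`):
`A_n(x) = Σ_{n ∣ m ≤ M} τ(m/n)·x_m/m`. [cite: Radziwill2012, §7 (the variables `y(ℓ)`) — derivation (GL(2) analogue, cell's Claim 1)] -/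
def selA (M : ℕ) (x : ℕ → ℝ) (n : ℕ) : ℝ :=
  ∑ m ∈ Icc 1 M, if n ∣ m then tauR (m / n) * (x m / m) else 0

/-- `Σ_{m≤M, n∣m} Λ(m/n)·A_m(x) = Σ_{a≤M, n∣a} (x_a/a)·Θ(a/n)`: the von Mangoldt coupling of the
Selberg coordinates collapses to `Θ`. [cite: Radziwill2012, §7 Lemma 11 — derivation (GL(2) analogue)] -/
theorem sum_vonMangoldt_selA {M n : ℕ} (hn : n ∈ Icc 1 M) (x : ℕ → ℝ) :
    ∑ m ∈ Icc 1 M, (if n ∣ m then Λ (m / n) * selA M x m else 0)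
      = ∑ a ∈ Icc 1 M, (if n ∣ a then x a / a * theta (a / n) else 0) := by
  have hn0 : n ≠ 0 := by have := (mem_Icc.mp hn).1; omega
  -- expand `selA` and exchange
  have h1 : ∑ m ∈ Icc 1 M, (if n ∣ m then Λ (m / n) * selA M x m else 0)
      = ∑ m ∈ Icc 1 M, ∑ a ∈ Icc 1 M, (if n ∣ m ∧ m ∣ a then Λ (m / n) * tauR (a / m) * (x a / a) else 0) := by
    refine sum_congr rfl fun m _ => ?_
    by_cases hnm : n ∣ m
    · rw [if_pos hnm]
      unfold selA; rw [mul_sum]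
      refine sum_congr rfl fun a _ => ?_
      by_cases hma : m ∣ a
      · rw [if_pos hma, if_pos ⟨hnm, hma⟩]; ring
      · rw [if_neg hma, if_neg (fun h => hma h.2)]; ring
    · rw [if_neg hnm]
      refine (sum_eq_zero fun a _ => ?_).symm
      rw [if_neg (fun h => hnm h.1)]
  rw [h1, sum_comm]
  refine sum_congr rfl fun a ha => ?_
  split_ifs with hna
  · have : ∑ m ∈ Icc 1 M, (if n ∣ m ∧ m ∣ a then Λ (m / n) * tauR (a / m) * (x a / a) else 0)
        = (x a / a) * ∑ m ∈ Icc 1 M, (if n ∣ m ∧ m ∣ a then Λ (m / n) * tauR (a / m) else 0) := by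
      rw [mul_sum]
      refine sum_congr rfl fun m _ => ?_
      split_ifs <;> ring
    rw [this, sum_Icc_ite_dvd_dvd ha hn0 hna (fun m => Λ (m / n) * tauR (a / m))]
    unfold theta tauR
    congr 1
    refine sum_congr rfl fun d hd => ?_
    rw [Nat.mul_div_cancel_left d (Nat.pos_of_ne_zero hn0), Nat.div_div_eq_div_mul]
  · refine sum_eq_zero fun m _ => ?_
    rw [if_neg]
    rintro ⟨hnm, hma⟩
    exact hna (hnm.trans hma)

/-- The cross term of `scForm` against the Selberg coordinates:
`Σ_m w(n,m)·A_n·A_m = φ(n)·A_n·Σ_{a≤M, n∣a}(x_a/a)Θ(a/n)` (`w(n,m) = φ(n)Λ(m/n)` on `n ∣ m`, and the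
diagonal term `m = n` vanishes as `Λ(1) = 0`). [cite: Radziwill2012, §7 Lemma 11 — derivation (GL(2) analogue)] -/
theorem sum_wt_selA {M n : ℕ} (hn : n ∈ Icc 1 M) (x : ℕ → ℝ) :
    ∑ m ∈ Icc 1 M, wt n m * selA M x n * selA M x m
      = (Nat.totient n : ℝ) * selA M x n *
          ∑ a ∈ Icc 1 M, (if n ∣ a then x a / a * theta (a / n) else 0) := by
  rw [← sum_vonMangoldt_selA hn x, mul_sum]
  refine sum_congr rfl fun m hm => ?_
  have hm1 : 1 ≤ m := (mem_Icc.mp hm).1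
  unfold wt
  by_cases hnm : n ∣ m
  · by_cases hlt : n < m
    · rw [if_pos ⟨hnm, hlt⟩, if_pos hnm]; ring
    · have hmn : m = n := by
        have := Nat.le_of_dvd (by omega) hnm
        omega
      subst hmn
      rw [if_neg (fun h => hlt h.2), if_pos hnm, Nat.div_self (by omega), vonMangoldt_apply_one]
      ring
  · rw [if_neg (fun h => hnm h.1), if_neg hnm]; ring

/-- **The bridge identity (the cell's Claim 1).** For every `M`, `L` and every real coefficient
vector `x`: `Σ_{a,b ≤ M} x_a x_b K(a,b) = F_{M,L}(A(x))` with `A(x)` the Selberg coordinates `selA`.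
[cite: KowalskiMichelVanderKam2000, (21)–(23) pp. 12–13 — derivation (Selberg coordinates; GL(2) analogue of Radziwill2012 §7 (7.2))] -/
theorem quadForm_kmvKernel_eq_scForm (M : ℕ) (L : ℝ) (x : ℕ → ℝ) :
    ∑ a ∈ Icc 1 M, ∑ b ∈ Icc 1 M, x a * x b * kmvKernel L a b = scForm M L (selA M x) := by
  set I := Icc 1 M with hI
  -- the three indicator-weighted pieces
  set P : ℕ → ℕ → ℝ := fun n a => if n ∣ a then tauR (a / n) * (x a / a) else 0 with hP
  set R : ℕ → ℕ → ℝ := fun n a => if n ∣ a then x a / a * theta (a / n) else 0 with hR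
  have hA : ∀ n, selA M x n = ∑ a ∈ I, P n a := fun n => rfl
  -- Step 1: pointwise rewrite of the summand through the per-pair identity
  have step1 : ∀ a ∈ I, ∀ b ∈ I, x a * x b * kmvKernel L a b
      = ∑ n ∈ I, ((Nat.totient n : ℝ) * (L + kappa n) * (P n a * P n b)
          - (Nat.totient n : ℝ) * (R n a * P n b) - (Nat.totient n : ℝ) * (P n a * R n b)) := by
    intro a ha b hb
    have ha0 : a ≠ 0 := by have := (mem_Icc.mp ha).1; omega
    have hb0 : b ≠ 0 := by have := (mem_Icc.mp hb).1; omega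
    have haR : (a : ℝ) ≠ 0 := by exact_mod_cast ha0
    have hbR : (b : ℝ) ≠ 0 := by exact_mod_cast hb0
    rw [kmvKernel_eq_kerNum_div, kerNum_eq ha0 hb0 L,
      sum_divisors_gcd_eq_sum_Icc_ite (fun n => (Nat.totient n : ℝ) * (L + kappa n) * tauR (a / n) * tauR (b / n)
        - (Nat.totient n : ℝ) * tauR (b / n) * theta (a / n)
        - (Nat.totient n : ℝ) * tauR (a / n) * theta (b / n)) ha hb]
    rw [← hI]
    have hfac : ∀ S : ℝ, x a * x b * (S / ((a : ℝ) * b)) = (x a / a * (x b / b)) * S := by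
      intro S; field_simp
    rw [hfac, mul_sum]
    refine sum_congr rfl fun n _ => ?_
    simp only [hP, hR]
    by_cases hna : n ∣ a
    · by_cases hnb : n ∣ b
      · rw [if_pos ⟨hna, hnb⟩, if_pos hna, if_pos hnb, if_pos hna, if_pos hnb]
        ring
      · rw [if_neg (fun h => hnb h.2), if_neg hnb, if_neg hnb]; ring
    · rw [if_neg (fun h => hna h.1), if_neg hna, if_neg hna]; ring
  -- Step 2: sum over a, b and exchange
  have step2 : ∑ a ∈ I, ∑ b ∈ I, x a * x b * kmvKernel L a b
      = ∑ n ∈ I, ((Nat.totient n : ℝ) * (L + kappa n) * (∑ a ∈ I, P n a) ^ 2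
          - 2 * ((Nat.totient n : ℝ) * (∑ a ∈ I, P n a) * ∑ b ∈ I, R n b)) := by
    calc ∑ a ∈ I, ∑ b ∈ I, x a * x b * kmvKernel L a b
        = ∑ a ∈ I, ∑ b ∈ I, ∑ n ∈ I, ((Nat.totient n : ℝ) * (L + kappa n) * (P n a * P n b)
            - (Nat.totient n : ℝ) * (R n a * P n b) - (Nat.totient n : ℝ) * (P n a * R n b)) := by
          refine sum_congr rfl fun a ha => sum_congr rfl fun b hb => step1 a ha b hb
      _ = ∑ n ∈ I, ∑ a ∈ I, ∑ b ∈ I, ((Nat.totient n : ℝ) * (L + kappa n) * (P n a * P n b)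
            - (Nat.totient n : ℝ) * (R n a * P n b) - (Nat.totient n : ℝ) * (P n a * R n b)) := by
          exact (sum_congr rfl fun a _ => sum_comm).trans sum_comm
      _ = ∑ n ∈ I, ((Nat.totient n : ℝ) * (L + kappa n) * (∑ a ∈ I, P n a) ^ 2
            - 2 * ((Nat.totient n : ℝ) * (∑ a ∈ I, P n a) * ∑ b ∈ I, R n b)) := by
          refine sum_congr rfl fun n _ => ?_
          have e1 : ∑ a ∈ I, ∑ b ∈ I, (Nat.totient n : ℝ) * (L + kappa n) * (P n a * P n b)
              = (Nat.totient n : ℝ) * (L + kappa n) * (∑ a ∈ I, P n a) ^ 2 := by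
            rw [sq, sum_mul_sum, mul_sum]
            refine sum_congr rfl fun a _ => ?_
            rw [mul_sum]
          have e2 : ∑ a ∈ I, ∑ b ∈ I, (Nat.totient n : ℝ) * (R n a * P n b)
              = (Nat.totient n : ℝ) * ((∑ b ∈ I, R n b) * ∑ a ∈ I, P n a) := by
            rw [sum_mul_sum, mul_sum]
            refine sum_congr rfl fun a _ => ?_
            rw [mul_sum]
          have e3 : ∑ a ∈ I, ∑ b ∈ I, (Nat.totient n : ℝ) * (P n a * R n b)
              = (Nat.totient n : ℝ) * ((∑ a ∈ I, P n a) * ∑ b ∈ I, R n b) := by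
            rw [sum_mul_sum, mul_sum]
            refine sum_congr rfl fun a _ => ?_
            rw [mul_sum]
          simp only [sum_sub_distrib]
          rw [e1, e2, e3]
          ring
  -- Step 3: the right-hand side
  have part2 : ∀ n ∈ I, (Nat.totient n : ℝ) * (∑ a ∈ I, P n a) * ∑ b ∈ I, R n b
      = ∑ m ∈ Icc 1 M, wt n m * selA M x n * selA M x m := by
    intro n hn
    rw [sum_wt_selA hn x, hA]
  rw [step2, sum_sub_distrib, ← mul_sum]
  unfold scForm
  have e1 : ∑ n ∈ I, (Nat.totient n : ℝ) * (L + kappa n) * (∑ a ∈ I, P n a) ^ 2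
      = ∑ n ∈ Icc 1 M, (Nat.totient n : ℝ) * (L + kappa n) * selA M x n ^ 2 :=
    sum_congr rfl fun n _ => by rw [hA]
  have e2 : ∑ n ∈ I, (Nat.totient n : ℝ) * (∑ a ∈ I, P n a) * ∑ b ∈ I, R n b
      = ∑ n ∈ Icc 1 M, ∑ m ∈ Icc 1 M, wt n m * selA M x n * selA M x m :=
    sum_congr rfl fun n hn => part2 n hn
  rw [e1, e2]


/-! ### The linear form and the consequences -/

/-- `(ζ ⋆ ζ)(e) = τ(e)`. [folklore] -/
private theorem zeta_mul_zeta_apply (e : ℕ) :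
    ((ζ : ArithmeticFunction ℝ) * ζ) e = tauR e := by
  rw [coe_mul_zeta_apply]
  have : ∀ i ∈ e.divisors, ((ζ : ArithmeticFunction ℝ)) i = 1 := by
    intro i hi
    have hi0 : i ≠ 0 := Nat.pos_iff_ne_zero.mp (Nat.pos_of_mem_divisors hi)
    rw [natCoe_apply, zeta_apply, if_neg hi0, Nat.cast_one]
  rw [sum_congr rfl this, sum_const, nsmul_eq_mul, mul_one]
  rfl

/-- Möbius inversion of `τ = 1 ⋆ 1`: `Σ_{n ∣ m} μ(n)·τ(m/n) = 1` (`m ≠ 0`). [folklore] -/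
private theorem sum_moebius_mul_tauR_div {m : ℕ} (hm : m ≠ 0) :
    ∑ n ∈ m.divisors, (μ n : ℝ) * tauR (m / n) = 1 := by
  have hconv : ((μ : ArithmeticFunction ℝ) * ((ζ : ArithmeticFunction ℝ) * ζ)) m
      = ((ζ : ArithmeticFunction ℝ)) m := by
    rw [← mul_assoc, coe_moebius_mul_coe_zeta, one_mul]
  rw [ArithmeticFunction.mul_apply,
    Nat.sum_divisorsAntidiagonal (fun i j => (μ : ArithmeticFunction ℝ) i * ((ζ : ArithmeticFunction ℝ) * ζ) j),
    natCoe_apply, zeta_apply, if_neg hm, Nat.cast_one] at hconv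
  rw [← hconv]
  refine sum_congr rfl fun n _ => ?_
  rw [zeta_mul_zeta_apply, intCoe_apply]

/-- **The linear form in Selberg coordinates**: `Σ_{a≤M} x_a/a = Σ_{n≤M} μ(n)·A_n(x)`
(Möbius inversion, `Σ_{n∣m} μ(n)τ(m/n) = 1`). [cite: Radziwill2012, §7 («By Moebius inversion») — derivation (GL(2) analogue, cell's Claim 1 (iv))] -/
theorem linForm_eq_mobForm (M : ℕ) (x : ℕ → ℝ) :
    ∑ a ∈ Icc 1 M, x a / a = mobForm M (selA M x) := by
  unfold mobForm selA
  -- exchange the sums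
  have h1 : ∑ n ∈ Icc 1 M, (ArithmeticFunction.moebius n : ℝ) *
        ∑ m ∈ Icc 1 M, (if n ∣ m then tauR (m / n) * (x m / m) else 0)
      = ∑ m ∈ Icc 1 M, (x m / m) * ∑ n ∈ Icc 1 M, (if n ∣ m ∧ n ∣ m then (μ n : ℝ) * tauR (m / n) else 0) := by
    simp only [mul_sum]
    rw [sum_comm]
    refine sum_congr rfl fun m _ => sum_congr rfl fun n _ => ?_
    by_cases h : n ∣ m
    · rw [if_pos h, if_pos ⟨h, h⟩]; ring
    · rw [if_neg h, if_neg (fun h' => h h'.1)]; ring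
  rw [h1]
  refine sum_congr rfl fun m hm => ?_
  have hm0 : m ≠ 0 := by have := (mem_Icc.mp hm).1; omega
  rw [← sum_divisors_gcd_eq_sum_Icc_ite (fun n => (μ n : ℝ) * tauR (m / n)) hm hm, Nat.gcd_self,
    sum_moebius_mul_tauR_div hm0, mul_one]

/-- **famE-09 at model level, for the KMV kernel itself.** Let `M ≥ 1` and `L, Λ♯, t ∈ ℝ` with
`cAM(n) − κ(n) ≤ Λ♯` for `n ≤ M` and `Λ♯ < L`, and put `m_* = L/G + P/G² − B(t)/(G²(L−Λ♯))`
(the explicit constant of `MollifierSelbergCoordinates`). Then for EVERY real coefficient vector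
`x`: `(Σ_{a≤M} x_a/a)²·m_* ≤ Σ_{a,b≤M} x_a x_b K(a,b)` — i.e. `sup_x ℓ(x)²/(xᵀKx) ≤ 1/m_*` in the
KMV `k = 0` harmonic main-term model (`xᵀKx = KMV2000.secondForm L 1 x`, `ℓ(x) = firstForm 1 x`).
[cite: Radziwill2012, §7 Proposition B (Soundararajan) — derivation (GL(2) analogue; the cell's famE-09 model theorem, Claim 1 + (FT))] -/
theorem linForm_sq_mul_le_quadForm {M : ℕ} (hM : 1 ≤ M) (L Λs t : ℝ)
    (hΛ : ∀ n ∈ Icc 1 M, cAM M n - kappa n ≤ Λs) (hL : Λs < L) (x : ℕ → ℝ) :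
    (∑ a ∈ Icc 1 M, x a / a) ^ 2
        * (L / scG M + scP M / scG M ^ 2 - scB M t / (scG M ^ 2 * (L - Λs)))
      ≤ ∑ a ∈ Icc 1 M, ∑ b ∈ Icc 1 M, x a * x b * kmvKernel L a b := by
  rw [quadForm_kmvKernel_eq_scForm, linForm_eq_mobForm]
  exact mobForm_sq_mul_le_scForm hM L Λs t hΛ hL _

/-- **The same bound for the typed amplified ratio at `A = 1`** (`KMVAmplifiedDiagonalForms`): for a
coefficient vector `x : ℕ →₀ ℝ` supported in `[1, M]` and `m_* > 0`,
`ampRatio L 1 x = (Σ x_n/n)²/(Σ x x K) ≤ 1/m_*`. (On the even class the harmonic proportion is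
`2 × ½ ×` this ratio in the cell's conventions; the asymptotics `m_* → 1 + 1/Δ` for `L = (log M)/Δ`
is not typed here.) [cite: KowalskiMichelVanderKam2000, Thm. 6.1 (32) p. 20 — derivation (model-level optimality of the single linear mollifier over arbitrary real coefficients)] -/
theorem ampRatio_one_le_inv {M : ℕ} (hM : 1 ≤ M) (L Λs t : ℝ)
    (hΛ : ∀ n ∈ Icc 1 M, cAM M n - kappa n ≤ Λs) (hL : Λs < L)
    (hm : 0 < L / scG M + scP M / scG M ^ 2 - scB M t / (scG M ^ 2 * (L - Λs)))
    (x : ℕ →₀ ℝ) (hx : x.support ⊆ Icc 1 M) :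
    ampRatio L one x ≤ 1 / (L / scG M + scP M / scG M ^ 2 - scB M t / (scG M ^ 2 * (L - Λs))) := by
  set mstar := L / scG M + scP M / scG M ^ 2 - scB M t / (scG M ^ 2 * (L - Λs)) with hmdef
  rw [ampRatio_one]
  -- convert the `Finsupp` sums to sums over `Icc 1 M`
  have hF : (x.sum fun n c => c / n) = ∑ a ∈ Icc 1 M, x a / a :=
    Finsupp.sum_of_support_subset x hx (fun n c => c / (n : ℝ)) (fun n _ => by simp)
  have hQ : (x.sum fun n₁ c₁ => x.sum fun n₂ c₂ => c₁ * c₂ * kmvKernel L n₁ n₂)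
      = ∑ a ∈ Icc 1 M, ∑ b ∈ Icc 1 M, x a * x b * kmvKernel L a b := by
    rw [Finsupp.sum_of_support_subset x hx _ (fun n _ => by simp)]
    refine sum_congr rfl fun a _ => ?_
    exact Finsupp.sum_of_support_subset x hx _ (fun n _ => by simp)
  rw [hF, hQ]
  have key := linForm_sq_mul_le_quadForm hM L Λs t hΛ hL (fun n => x n)
  rw [← hmdef] at key
  set F := ∑ a ∈ Icc 1 M, x a / a
  set Q := ∑ a ∈ Icc 1 M, ∑ b ∈ Icc 1 M, x a * x b * kmvKernel L a b
  have hQnn : 0 ≤ Q := le_trans (mul_nonneg (sq_nonneg F) hm.le) key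
  rcases hQnn.eq_or_lt with hQ0 | hQpos
  · rw [← hQ0, div_zero]; positivity
  · rw [div_le_div_iff₀ hQpos hm, one_mul]
    exact key

end Literature.NumberTheory.LFunctions.KMV2000.SelbergCoord
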